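import Summits.SmoothPoincare4.SmoothPoincare4.Theorems.SymplecticOrigamiGromovRecognitionRelEndGlueData
import Summits.SmoothPoincare4.SmoothPoincare4.Theorems.SymplecticOrigamiGromovRecognitionRelEndGluedBasics
import Summits.SmoothPoincare4.SmoothPoincare4.Theorems.SymplecticOrigamiGromovRecognitionRelEndWedgeSphereH
import Summits.SmoothPoincare4.SmoothPoincare4.Theorems.SymplecticOrigamiGromovRecognitionRelEndWedgeSphereV
import Summits.SmoothPoincare4.SmoothPoincare4.Theorems.SymplecticOrigamiGromovRecognitionRelEndWedgeSphereEmb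
import Summits.SmoothPoincare4.SmoothPoincare4.Theorems.SymplecticOrigamiGromovRecognitionRelEndWedgeCoordinateV
import Summits.SmoothPoincare4.SmoothPoincare4.Theorems.SymplecticOrigamiGromovRecognitionRelEndWedgeCoordinateDerivNeZeroV
import Summits.SmoothPoincare4.SmoothPoincare4.Theorems.SymplecticOrigamiGromovRecognitionRelEndWedgeLevelH
import Summits.SmoothPoincare4.SmoothPoincare4.Theorems.SymplecticOrigamiGromovRecognitionRelEndWedgeLevelV
import Summits.SmoothPoincare4.SmoothPoincare4.Theorems.SymplecticOrigamiGromovRecognitionRelEndVinfSphereHCount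
import Summits.SmoothPoincare4.SmoothPoincare4.Theorems.SymplecticOrigamiGromovRecognitionRelEndVinfLevelHCount
import Summits.SmoothPoincare4.SmoothPoincare4.Theorems.SymplecticOrigamiGromovRecognitionRelEndHinfSphereVCount
import Summits.SmoothPoincare4.SmoothPoincare4.Theorems.SymplecticOrigamiGromovRecognitionRelEndHinfLevelVCount
import Summits.SmoothPoincare4.SmoothPoincare4.Theorems.SymplecticOrigamiGromovRecognitionRelEndOffWedgeMemRange
import Summits.SmoothPoincare4.SmoothPoincare4.Theorems.SymplecticOrigamiGromovRecognitionRelEndNoJSpheresInImage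
import Summits.SmoothPoincare4.SmoothPoincare4.Theorems.SymplecticOrigamiGromovRecognitionRelEndWedgeAxisNullHomotopic

/-!
# The concrete foliation data of the wedge cap
(registered helper `helper_capFoliationData` of line `cross-cap-laurent`, crux
`GromovRecognitionRelEnd`, item stmt-SmoothPoincare4-11009; consumed by `stub_coreGlue`)

From the cap block of `stub_capModel` (taming form `ωX`, the local diffeomorphism `ι : M → X`
intertwining `J` and `JX`, the three `JX`-holomorphic cap charts `ηV`, `ηH`, `ηC` of the wedge cap
`X` with their gluing identities and the cover clause), `π₂(M) = 0`, `0 < R₁` and the three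
wedge-disjointness clauses, we assemble the two `FoliationData` packages of the bi-foliation
argument:

* the `V`-fibration data: reference sphere `V∞ = (u₀, v₀)` (`u₀ z = ηV (0, 0, z)`, `v₀ 0 = ηC 0`,
  glued map `F₀`), transverse wedge sphere `H∞ = (uH, vH)` (`uH z = ηH (z, 0, 0)`, `vH 0 = ηC 0`),
  the holomorphic wedge coordinates `TH` on `UH = ηH '' D_H ∪ ηC '' D_C` and `TV` on
  `UV = ηV '' D_V ∪ ηC '' D_C`, `δ = R₁⁻¹`;
* the `H`-fibration data, obtained from the `V`-data by `helper_foliationData_symm`.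

There is no new mathematics here: every field is one of the landed concrete cap helpers (the
imports); the only work is the elementary casework showing that the two affine wedge axes miss
the opposite coordinate domains at the origin (`ηV 0 ∉ UH`, `ηH 0 ∉ UV`) and that the two wedge
spheres meet only at the corner.
-/

noncomputable section

open scoped Manifold ContDiff Topology
open Set Function Filter Literature.Topology.FourManifolds Literature.Topology.FourManifolds.ComplexProjectiveSpace
  Literature.Geometry.Kaehler Literature.Geometry.Symplectic

-- the prescribed namespace `Summit.<P>.<Sub>.…` duplicates `SmoothPoincare4` (P = Sub)
set_option linter.dupNamespace false

namespace Summit.SmoothPoincare4.SmoothPoincare4.Theorems.GromovRecognitionRelEnd.CrossCapLaurent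

/-- Model space `ℝ⁴ = ℂ²` (coordinates `0,1` = `z₁`, `2,3` = `z₂`). -/
local notation "E4" => EuclideanSpace ℝ (Fin 4)

namespace CapFoliationData

/-- The origin of `ℝ⁴` written as the axis point `(0, 0, re 0, im 0)` / `(re 0, im 0, 0, 0)`. -/
theorem toLp_zero_eq : (WithLp.toLp 2 ![(0 : ℝ), 0, 0, 0] : E4) = 0 := by
  ext i; fin_cases i <;> simp

/-- **The `V`-axis origin misses the `H`-coordinate domain**: `ηV 0 ∉ UH = ηH '' D_H ∪ ηC '' D_C`.
Casework through the gluing clauses: a point of `ηH '' D_H` off the `H`-axis is in `range ι`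
(excluded for `V`-axis points), on the `H`-axis it is excluded by the disjointness of the two
axes; a point `ηC p'` of the corner image is `ηV` of a point of `D_V` with nonzero second factor
(excluded by injectivity of `ηV`), or an `H`-axis point, or the corner `ηC 0`. -/
theorem axisV_zero_notMem {M X : Type} {R₁ : ℝ} {χ : E4 → M} {ι : M → X} {ηH ηV ηC : E4 → X}
    (hVinj : Set.InjOn ηV {p : E4 | p 0 ^ 2 + p 1 ^ 2 < R₁⁻¹ ^ 2})
    (hVaxis : ∀ p : E4, p 0 = 0 → p 1 = 0 → ηV p ∉ Set.range ι)
    (hHcap : ∀ p : E4, p 2 ^ 2 + p 3 ^ 2 < R₁⁻¹ ^ 2 → (p 2 ≠ 0 ∨ p 3 ≠ 0) →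
      ηH p = ι (χ (WithLp.toLp 2
        ![p 0, p 1, p 2 / (p 2 ^ 2 + p 3 ^ 2), -(p 3) / (p 2 ^ 2 + p 3 ^ 2)])))
    (hCV : ∀ p : E4, p 0 ^ 2 + p 1 ^ 2 < R₁⁻¹ ^ 2 → p 2 ^ 2 + p 3 ^ 2 < R₁⁻¹ ^ 2 →
      (p 2 ≠ 0 ∨ p 3 ≠ 0) →
      ηC p = ηV (WithLp.toLp 2 ![p 0, p 1, p 2 / (p 2 ^ 2 + p 3 ^ 2), -(p 3) / (p 2 ^ 2 + p 3 ^ 2)]))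
    (hCH : ∀ p : E4, p 0 ^ 2 + p 1 ^ 2 < R₁⁻¹ ^ 2 → p 2 ^ 2 + p 3 ^ 2 < R₁⁻¹ ^ 2 →
      (p 0 ≠ 0 ∨ p 1 ≠ 0) →
      ηC p = ηH (WithLp.toLp 2 ![p 0 / (p 0 ^ 2 + p 1 ^ 2), -(p 1) / (p 0 ^ 2 + p 1 ^ 2), p 2, p 3]))
    (hdHV : ∀ p q : E4, p 2 = 0 → p 3 = 0 → q 0 = 0 → q 1 = 0 → ηH p ≠ ηV q)
    (hdV : ∀ q : E4, q 0 = 0 → q 1 = 0 → ηV q ≠ ηC 0) (hR₁ : 0 < R₁) :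
    ηV 0 ∉ ηH '' {p : E4 | p 2 ^ 2 + p 3 ^ 2 < R₁⁻¹ ^ 2} ∪
      ηC '' {p : E4 | p 0 ^ 2 + p 1 ^ 2 < R₁⁻¹ ^ 2 ∧ p 2 ^ 2 + p 3 ^ 2 < R₁⁻¹ ^ 2} := by
  have hR : (0 : ℝ) < R₁⁻¹ ^ 2 := by positivity
  rintro (⟨p, hp, hpe⟩ | ⟨p, ⟨hp₁, hp₂⟩, hpe⟩)
  · -- `ηH p = ηV 0`, `p ∈ D_H`
    by_cases h23 : p 2 ≠ 0 ∨ p 3 ≠ 0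
    · exact hVaxis 0 (by simp) (by simp) ⟨_, (hHcap p hp h23).symm.trans hpe⟩
    · push Not at h23
      exact hdHV p 0 h23.1 h23.2 (by simp) (by simp) hpe
  · -- `ηC p = ηV 0`, `p ∈ D_C`
    by_cases h23 : p 2 ≠ 0 ∨ p 3 ≠ 0
    · have hq := hCV p hp₁ hp₂ h23
      have hne : p 2 ^ 2 + p 3 ^ 2 ≠ 0 := by
        rcases h23 with h | h <;> positivity
      have heq : (WithLp.toLp 2 ![p 0, p 1, p 2 / (p 2 ^ 2 + p 3 ^ 2),
          -(p 3) / (p 2 ^ 2 + p 3 ^ 2)] : E4) = 0 :=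
        hVinj (by simpa using hp₁) (by simpa using hR) (hq.symm.trans hpe)
      have h2 : p 2 / (p 2 ^ 2 + p 3 ^ 2) = 0 := by simpa using congrArg (fun q : E4 => q 2) heq
      have h3 : -(p 3) / (p 2 ^ 2 + p 3 ^ 2) = 0 := by
        simpa using congrArg (fun q : E4 => q 3) heq
      rw [div_eq_zero_iff, or_iff_left hne] at h2 h3
      rcases h23 with h | h
      · exact h h2
      · exact h (neg_eq_zero.mp h3)
    · push Not at h23
      by_cases h01 : p 0 ≠ 0 ∨ p 1 ≠ 0
      · have hq := hCH p hp₁ hp₂ h01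
        exact hdHV _ 0 (by simp [h23.1]) (by simp [h23.2]) (by simp) (by simp) (hq.symm.trans hpe)
      · push Not at h01
        have hp0 : p = 0 := by
          ext i
          fin_cases i
          · simpa using h01.1
          · simpa using h01.2
          · simpa using h23.1
          · simpa using h23.2
        rw [hp0] at hpe
        exact hdV 0 (by simp) (by simp) hpe.symm

/-- **The `H`-axis origin misses the `V`-coordinate domain**: `ηH 0 ∉ UV = ηV '' D_V ∪ ηC '' D_C`
(mirror of `axisV_zero_notMem`, the roles of the two complex factors exchanged). -/
theorem axisH_zero_notMem {M X : Type} {R₁ : ℝ} {χ : E4 → M} {ι : M → X} {ηH ηV ηC : E4 → X}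
    (hHinj : Set.InjOn ηH {p : E4 | p 2 ^ 2 + p 3 ^ 2 < R₁⁻¹ ^ 2})
    (hHaxis : ∀ p : E4, p 2 = 0 → p 3 = 0 → ηH p ∉ Set.range ι)
    (hVcap : ∀ p : E4, p 0 ^ 2 + p 1 ^ 2 < R₁⁻¹ ^ 2 → (p 0 ≠ 0 ∨ p 1 ≠ 0) →
      ηV p = ι (χ (WithLp.toLp 2
        ![p 0 / (p 0 ^ 2 + p 1 ^ 2), -(p 1) / (p 0 ^ 2 + p 1 ^ 2), p 2, p 3])))
    (hCV : ∀ p : E4, p 0 ^ 2 + p 1 ^ 2 < R₁⁻¹ ^ 2 → p 2 ^ 2 + p 3 ^ 2 < R₁⁻¹ ^ 2 →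
      (p 2 ≠ 0 ∨ p 3 ≠ 0) →
      ηC p = ηV (WithLp.toLp 2 ![p 0, p 1, p 2 / (p 2 ^ 2 + p 3 ^ 2), -(p 3) / (p 2 ^ 2 + p 3 ^ 2)]))
    (hCH : ∀ p : E4, p 0 ^ 2 + p 1 ^ 2 < R₁⁻¹ ^ 2 → p 2 ^ 2 + p 3 ^ 2 < R₁⁻¹ ^ 2 →
      (p 0 ≠ 0 ∨ p 1 ≠ 0) →
      ηC p = ηH (WithLp.toLp 2 ![p 0 / (p 0 ^ 2 + p 1 ^ 2), -(p 1) / (p 0 ^ 2 + p 1 ^ 2), p 2, p 3]))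
    (hdHV : ∀ p q : E4, p 2 = 0 → p 3 = 0 → q 0 = 0 → q 1 = 0 → ηH p ≠ ηV q)
    (hdH : ∀ p : E4, p 2 = 0 → p 3 = 0 → ηH p ≠ ηC 0) (hR₁ : 0 < R₁) :
    ηH 0 ∉ ηV '' {p : E4 | p 0 ^ 2 + p 1 ^ 2 < R₁⁻¹ ^ 2} ∪
      ηC '' {p : E4 | p 0 ^ 2 + p 1 ^ 2 < R₁⁻¹ ^ 2 ∧ p 2 ^ 2 + p 3 ^ 2 < R₁⁻¹ ^ 2} := by
  have hR : (0 : ℝ) < R₁⁻¹ ^ 2 := by positivity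
  rintro (⟨p, hp, hpe⟩ | ⟨p, ⟨hp₁, hp₂⟩, hpe⟩)
  · -- `ηV p = ηH 0`, `p ∈ D_V`
    by_cases h01 : p 0 ≠ 0 ∨ p 1 ≠ 0
    · exact hHaxis 0 (by simp) (by simp) ⟨_, (hVcap p hp h01).symm.trans hpe⟩
    · push Not at h01
      exact hdHV 0 p (by simp) (by simp) h01.1 h01.2 hpe.symm
  · -- `ηC p = ηH 0`, `p ∈ D_C`
    by_cases h01 : p 0 ≠ 0 ∨ p 1 ≠ 0
    · have hq := hCH p hp₁ hp₂ h01
      have hne : p 0 ^ 2 + p 1 ^ 2 ≠ 0 := by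
        rcases h01 with h | h <;> positivity
      have heq : (WithLp.toLp 2 ![p 0 / (p 0 ^ 2 + p 1 ^ 2), -(p 1) / (p 0 ^ 2 + p 1 ^ 2),
          p 2, p 3] : E4) = 0 :=
        hHinj (by simpa using hp₂) (by simpa using hR) (hq.symm.trans hpe)
      have h0 : p 0 / (p 0 ^ 2 + p 1 ^ 2) = 0 := by simpa using congrArg (fun q : E4 => q 0) heq
      have h1 : -(p 1) / (p 0 ^ 2 + p 1 ^ 2) = 0 := by
        simpa using congrArg (fun q : E4 => q 1) heq
      rw [div_eq_zero_iff, or_iff_left hne] at h0 h1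
      rcases h01 with h | h
      · exact h h0
      · exact h (neg_eq_zero.mp h1)
    · push Not at h01
      by_cases h23 : p 2 ≠ 0 ∨ p 3 ≠ 0
      · have hq := hCV p hp₁ hp₂ h23
        exact hdHV 0 _ (by simp) (by simp) (by simp [h01.1]) (by simp [h01.2]) (hpe.symm.trans hq)
      · push Not at h23
        have hp0 : p = 0 := by
          ext i
          fin_cases i
          · simpa using h01.1
          · simpa using h01.2
          · simpa using h23.1
          · simpa using h23.2
        rw [hp0] at hpe
        exact hdH 0 (by simp) (by simp) hpe.symm

end CapFoliationData

open CapFoliationData in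
/-- **C6: the concrete foliation data of the wedge cap, both ways**, with the chart
identifications of the two wedge spheres (`u₀ z = ηV (0, 0, z)`, `v₀ 0 = ηC 0`,
`uH z = ηH (z, 0, 0)`, `vH 0 = ηC 0`).  See the module docstring. -/
theorem helper_capFoliationData :
    ∀ (M : Type) [TopologicalSpace M] [T2Space M] [SecondCountableTopology M]
      [ChartedSpace (E4) M] [IsManifold (𝓡 4) ∞ M] [ConnectedSpace M]
      (J : AlmostComplexStructure (𝓡 4) ∞ M) (R₁ : ℝ) (χ : E4 → M),
      (∀ x : M, Subsingleton (π_ 2 M x)) →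
      0 < R₁ →
      ∀ (X : Type) [TopologicalSpace X] [T2Space X] [SecondCountableTopology X] [CompactSpace X]
        [ConnectedSpace X] [ChartedSpace (E4) X] [IsManifold (𝓡 4) ∞ X]
        (ωX : MForm (𝓡 4) X ℝ 2) (JX : AlmostComplexStructure (𝓡 4) ∞ X) (ι : M → X)
        (ηH ηV ηC : E4 → X),
        (IsSmoothForm ωX ∧ IsClosedForm ωX ∧ JX.IsTamedBy ωX) ∧
        (IsLocalDiffeomorph (𝓡 4) (𝓡 4) ∞ ι ∧ Function.Injective ι ∧
          ∀ (x : M) (v : TangentSpace (𝓡 4) x),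
            JX (ι x) (mfderiv (𝓡 4) (𝓡 4) ι x v) = mfderiv (𝓡 4) (𝓡 4) ι x (J x v)) ∧
        (IsLocalDiffeomorphOn 𝓘(ℝ, E4) (𝓡 4) ∞ ηV
            {p : E4 | p 0 ^ 2 + p 1 ^ 2 < R₁⁻¹ ^ 2} ∧
          Set.InjOn ηV {p : E4 | p 0 ^ 2 + p 1 ^ 2 < R₁⁻¹ ^ 2} ∧
          (∀ p : E4, p 0 ^ 2 + p 1 ^ 2 < R₁⁻¹ ^ 2 → (p 0 ≠ 0 ∨ p 1 ≠ 0) →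
            ηV p = ι (χ (WithLp.toLp 2
              ![p 0 / (p 0 ^ 2 + p 1 ^ 2), -(p 1) / (p 0 ^ 2 + p 1 ^ 2), p 2, p 3]))) ∧
          (∀ p : E4, p 0 = 0 → p 1 = 0 → ηV p ∉ Set.range ι) ∧
          (∀ p : E4, p 0 ^ 2 + p 1 ^ 2 < R₁⁻¹ ^ 2 →
            ∀ q : E4,
            JX (ηV p) (mfderiv 𝓘(ℝ, E4) (𝓡 4) ηV p q) =
              mfderiv 𝓘(ℝ, E4) (𝓡 4) ηV p
                (WithLp.toLp 2 ![-(q 1), q 0, -(q 3), q 2]))) ∧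
        (IsLocalDiffeomorphOn 𝓘(ℝ, E4) (𝓡 4) ∞ ηH
            {p : E4 | p 2 ^ 2 + p 3 ^ 2 < R₁⁻¹ ^ 2} ∧
          Set.InjOn ηH {p : E4 | p 2 ^ 2 + p 3 ^ 2 < R₁⁻¹ ^ 2} ∧
          (∀ p : E4, p 2 ^ 2 + p 3 ^ 2 < R₁⁻¹ ^ 2 → (p 2 ≠ 0 ∨ p 3 ≠ 0) →
            ηH p = ι (χ (WithLp.toLp 2
              ![p 0, p 1, p 2 / (p 2 ^ 2 + p 3 ^ 2), -(p 3) / (p 2 ^ 2 + p 3 ^ 2)]))) ∧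
          (∀ p : E4, p 2 = 0 → p 3 = 0 → ηH p ∉ Set.range ι) ∧
          (∀ p : E4, p 2 ^ 2 + p 3 ^ 2 < R₁⁻¹ ^ 2 →
            ∀ q : E4,
            JX (ηH p) (mfderiv 𝓘(ℝ, E4) (𝓡 4) ηH p q) =
              mfderiv 𝓘(ℝ, E4) (𝓡 4) ηH p
                (WithLp.toLp 2 ![-(q 1), q 0, -(q 3), q 2]))) ∧
        (IsLocalDiffeomorphOn 𝓘(ℝ, E4) (𝓡 4) ∞ ηC
            {p : E4 | p 0 ^ 2 + p 1 ^ 2 < R₁⁻¹ ^ 2 ∧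
              p 2 ^ 2 + p 3 ^ 2 < R₁⁻¹ ^ 2} ∧
          Set.InjOn ηC {p : E4 | p 0 ^ 2 + p 1 ^ 2 < R₁⁻¹ ^ 2 ∧
            p 2 ^ 2 + p 3 ^ 2 < R₁⁻¹ ^ 2} ∧
          (∀ p : E4, p 0 ^ 2 + p 1 ^ 2 < R₁⁻¹ ^ 2 →
            p 2 ^ 2 + p 3 ^ 2 < R₁⁻¹ ^ 2 → (p 2 ≠ 0 ∨ p 3 ≠ 0) →
            ηC p = ηV (WithLp.toLp 2
              ![p 0, p 1, p 2 / (p 2 ^ 2 + p 3 ^ 2), -(p 3) / (p 2 ^ 2 + p 3 ^ 2)])) ∧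
          (∀ p : E4, p 0 ^ 2 + p 1 ^ 2 < R₁⁻¹ ^ 2 →
            p 2 ^ 2 + p 3 ^ 2 < R₁⁻¹ ^ 2 → (p 0 ≠ 0 ∨ p 1 ≠ 0) →
            ηC p = ηH (WithLp.toLp 2
              ![p 0 / (p 0 ^ 2 + p 1 ^ 2), -(p 1) / (p 0 ^ 2 + p 1 ^ 2), p 2, p 3])) ∧
          ηC 0 ∉ Set.range ι ∧
          (∀ p : E4, p 0 ^ 2 + p 1 ^ 2 < R₁⁻¹ ^ 2 →
            p 2 ^ 2 + p 3 ^ 2 < R₁⁻¹ ^ 2 → ∀ q : E4,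
            JX (ηC p) (mfderiv 𝓘(ℝ, E4) (𝓡 4) ηC p q) =
              mfderiv 𝓘(ℝ, E4) (𝓡 4) ηC p
                (WithLp.toLp 2 ![-(q 1), q 0, -(q 3), q 2]))) ∧
        (∀ y : X, y ∈ Set.range ι ∨
          (∃ p : E4, p 0 ^ 2 + p 1 ^ 2 < R₁⁻¹ ^ 2 ∧ ηV p = y) ∨
          (∃ p : E4, p 2 ^ 2 + p 3 ^ 2 < R₁⁻¹ ^ 2 ∧ ηH p = y) ∨
          (∃ p : E4, (p 0 ^ 2 + p 1 ^ 2 < R₁⁻¹ ^ 2 ∧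
            p 2 ^ 2 + p 3 ^ 2 < R₁⁻¹ ^ 2) ∧ ηC p = y)) →
        (∀ p q : E4, p 2 = 0 → p 3 = 0 → q 0 = 0 → q 1 = 0 → ηH p ≠ ηV q) →
        (∀ p : E4, p 2 = 0 → p 3 = 0 → ηH p ≠ ηC 0) →
        (∀ q : E4, q 0 = 0 → q 1 = 0 → ηV q ≠ ηC 0) →
        ∃ (u₀ v₀ uH vH : ℂ → X) (F₀ FH : C(ComplexProjectiveSpace 1, X)) (TH TV : X → ℂ)
          (UH UV : Set X) (δ : ℝ),
          FoliationData ωX JX u₀ v₀ uH vH F₀ TH TV UH UV δ ∧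
          FoliationData ωX JX uH vH u₀ v₀ FH TV TH UV UH δ ∧
          (∀ z : ℂ, u₀ z = ηV (WithLp.toLp 2 ![0, 0, z.re, z.im])) ∧ v₀ 0 = ηC 0 ∧
          (∀ z : ℂ, uH z = ηH (WithLp.toLp 2 ![z.re, z.im, 0, 0])) ∧ vH 0 = ηC 0 := by
  intro M _ _ _ _ _ _ J R₁ χ hπ hR₁ X _ _ _ _ _ _ _ ωX JX ι ηH ηV ηC hcap hdHV hdH hdV
  obtain ⟨⟨hωs, hωc, hωt⟩, ⟨hιloc, hιinj, hιJ⟩, ⟨hVloc, hVinj, hVcap, hVaxis, hVhol⟩,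
    ⟨hHloc, hHinj, hHcap, hHaxis, hHhol⟩, ⟨hCloc, hCinj, hCV, hCH, hC0, hChol⟩, hcover⟩ := hcap
  -- the two wedge spheres `H∞ = (uH, vH)` and `V∞ = (u₀, v₀)` as smooth `JX`-holomorphic pairs
  obtain ⟨uH, vH, hsuH, hsvH, hcompH, hholuH, hholvH, huH, hvH⟩ :=
    helper_wedgeSphereH X JX R₁ ηH ηC hR₁ hHloc hHhol hCloc hCH hChol
  obtain ⟨u₀, v₀, hsu₀, hsv₀, hcomp₀, hholu₀, hholv₀, hu₀, hv₀⟩ :=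
    helper_wedgeSphereV X JX R₁ ηV ηC hR₁ hVloc hVhol hCloc hCV hChol
  -- the two holomorphic wedge coordinates `TH` on `UH`, `TV` on `UV`
  obtain ⟨TH, hUHo, hTHs, hTHhol, hreadHH, hreadHC, hzeroH⟩ :=
    helper_wedgeCoordinateH M X (fun y => JX y) R₁ χ ι ηH ηV ηC hR₁ hHloc hHinj hHhol hCloc hCinj
      hChol hHcap hVaxis hCV hCH hC0 hdHV
  obtain ⟨TV, hUVo, hTVs, hTVhol, hreadVV, hreadVC, hzeroV⟩ :=
    helper_wedgeCoordinateV M X (fun y => JX y) R₁ χ ι ηH ηV ηC hR₁ hVloc hVinj hVhol hCloc hCinj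
      hChol hVcap hHaxis hCH hCV hC0 hdHV
  obtain ⟨F₀, hF₀0, hF₀1⟩ := helper_gluedExists X u₀ v₀ hsu₀.continuous hsv₀.continuous hcomp₀
  obtain ⟨FH, hFH0, hFH1⟩ := helper_gluedExists X uH vH hsuH.continuous hsvH.continuous hcompH
  have hembV :=
    helper_wedgeSphereEmbV X R₁ ηV ηC u₀ v₀ hR₁ hVloc hVinj hCloc hCV hdV hsv₀ hu₀ hv₀ hcomp₀
  have hembH :=
    helper_wedgeSphereEmbH X R₁ ηH ηC uH vH hR₁ hHloc hHinj hCloc hCH hdH hsvH huH hvH hcompH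
  have hlevelH := helper_wedgeLevelSetH X R₁ ηH ηC TH hR₁ hCH hreadHH hreadHC
  have hlevelV := helper_wedgeLevelSetV X R₁ ηV ηC TV hR₁ hCV hreadVV hreadVC
  have hu₀0 : u₀ 0 = ηV 0 := by rw [hu₀, Complex.zero_re, Complex.zero_im, toLp_zero_eq]
  have huH0 : uH 0 = ηH 0 := by rw [huH, Complex.zero_re, Complex.zero_im, toLp_zero_eq]
  have hruH : Set.range uH = Set.range (fun z : ℂ => ηH (WithLp.toLp 2 ![z.re, z.im, 0, 0])) :=
    congrArg Set.range (funext huH)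
  have hru₀ : Set.range u₀ = Set.range (fun z : ℂ => ηV (WithLp.toLp 2 ![0, 0, z.re, z.im])) :=
    congrArg Set.range (funext hu₀)
  -- a point off both wedge spheres is in `range ι`
  have hoff : ∀ y : X, y ∉ pairImage uH vH ∪ pairImage u₀ v₀ → y ∈ Set.range ι := by
    intro y hy
    refine helper_offWedgeMemRange M X R₁ χ ι ηH ηV ηC hVcap hHcap hCV hCH hcover y ?_ ?_ ?_
    · intro p hp2 hp3 heq
      refine hy (Set.mem_union_left _ ((mem_pairImage_iff _ _ _).2 (Or.inl ⟨⟨p 0, p 1⟩, ?_⟩)))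
      rw [huH, ← heq]
      congr 1
      ext i
      fin_cases i <;> simp [hp2, hp3]
    · intro q hq0 hq1 heq
      refine hy (Set.mem_union_right _ ((mem_pairImage_iff _ _ _).2 (Or.inl ⟨⟨q 2, q 3⟩, ?_⟩)))
      rw [hu₀, ← heq]
      congr 1
      ext i
      fin_cases i <;> simp [hq0, hq1]
    · intro heq
      exact hy (Set.mem_union_left _ ((mem_pairImage_iff _ _ _).2 (Or.inr (heq.trans hvH.symm))))
  -- the `V`-fibration data
  have D : FoliationData ωX JX u₀ v₀ uH vH F₀ TH TV
      (ηH '' {p : E4 | p 2 ^ 2 + p 3 ^ 2 < R₁⁻¹ ^ 2} ∪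
        ηC '' {p : E4 | p 0 ^ 2 + p 1 ^ 2 < R₁⁻¹ ^ 2 ∧ p 2 ^ 2 + p 3 ^ 2 < R₁⁻¹ ^ 2})
      (ηV '' {p : E4 | p 0 ^ 2 + p 1 ^ 2 < R₁⁻¹ ^ 2} ∪
        ηC '' {p : E4 | p 0 ^ 2 + p 1 ^ 2 < R₁⁻¹ ^ 2 ∧ p 2 ^ 2 + p 3 ^ 2 < R₁⁻¹ ^ 2}) R₁⁻¹ :=
    { smoothForm := hωs
      closedForm := hωc
      tamed := hωt
      ref_sphere := ⟨hsu₀, hsv₀, hcomp₀, hholu₀, hholv₀⟩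
      ref_embedded := ⟨hembV.1, hembV.2.1, hembV.2.2.1, hembV.2.2.2⟩
      ref_glued := ⟨hF₀0, hF₀1⟩
      wedge_sphere := ⟨hsuH, hsvH, hcompH, hholuH, hholvH⟩
      coordH := ⟨hUHo, hTHs, hTHhol,
        helper_wedgeCoordinateDerivNeZero X R₁ ηH ηC TH hR₁ hHloc hCloc hUHo hTHs hreadHH hreadHC⟩
      coordV := ⟨hUVo, hTVs, hTVhol,
        helper_wedgeCoordinateDerivNeZeroV X R₁ ηV ηC TV hR₁ hVloc hCloc hUVo hTVs hreadVV hreadVC⟩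
      zeroSetH := by rw [hzeroH, pairImage_eq, hruH, hvH]
      zeroSetV := by rw [hzeroV, pairImage_eq, hru₀, hv₀]
      levelsH := helper_wedgeLevelCompactH X R₁ ηH ηC TH hR₁ hHloc.contMDiffOn.continuousOn
        hCloc.contMDiffOn.continuousOn hCH hreadHH hreadHC
      levelsV := helper_wedgeLevelCompactV X R₁ ηV ηC TV hR₁ hVloc.contMDiffOn.continuousOn
        hCloc.contMDiffOn.continuousOn hCV hreadVV hreadVC
      δ_pos := inv_pos.mpr hR₁
      count_ref := by
        intro t ht
        rw [wedgeCount_eq]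
        by_cases ht0 : t = 0
        · subst ht0
          exact helper_vinfSphereHCount X R₁ ηH ηV ηC (fun y => TH y - 0) u₀ v₀ hR₁
            (fun p h₁ h₂ => by simp only [sub_zero]; exact hreadHC p h₁ h₂)
            (by simp only [sub_zero]; exact hzeroH) hu₀ hv₀ hcomp₀ hCV hdHV hdV
        · exact helper_vinfLevelHCount X M R₁ χ ι ηH ηV ηC TH u₀ v₀ hR₁ hVinj hVaxis hHcap hCV
            hreadHC hlevelH hu₀ hv₀ hcomp₀ t ht0 ht
      ref_off := by
        rw [hu₀0]
        exact axisV_zero_notMem hVinj hVaxis hHcap hCV hCH hdHV hdV hR₁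
      corner := hvH.trans hv₀.symm
      inter_eq := by
        ext y
        simp only [Set.mem_inter_iff, mem_pairImage_iff, Set.mem_singleton_iff]
        constructor
        · rintro ⟨⟨z, hz⟩ | h₁, ⟨z', hz'⟩ | h₂⟩
          · refine absurd (hz.trans hz'.symm) ?_
            rw [huH, hu₀]
            exact hdHV _ _ (by simp) (by simp) (by simp) (by simp)
          · exact h₂
          · rw [h₁, hvH, hv₀]
          · exact h₂
        · intro h
          exact ⟨Or.inr (by rw [h, hvH, hv₀]), Or.inr h⟩
      pi2 := fun u v huv hu hv =>
        helper_noJSpheresInImage M X J JX ωX ι u v hπ hωs hωc hωt hιloc hιinj hιJ huv.smooth_u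
          huv.smooth_v huv.compat huv.hol_u huv.hol_v (fun z => hoff _ (hu z)) fun z => by
          by_cases hz : z = 0
          · subst hz
            exact hoff _ hv
          · rw [huv.compat z hz]
            exact hoff _ (hu _)
      nullH := fun G hG =>
        helper_wedgeAxisNullHomotopicH X R₁ ηH hR₁ hHloc hHinj G fun y hy => by
          obtain ⟨hy₁, hy₂⟩ := hG hy
          rcases (mem_pairImage_iff _ _ _).1 hy₁ with ⟨z, rfl⟩ | h
          · exact ⟨z, (huH z).symm⟩
          · exact absurd (h.trans (hvH.trans hv₀.symm)) hy₂
      nullV := fun G hG =>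
        helper_wedgeAxisNullHomotopicV X R₁ ηV hR₁ hVloc hVinj G fun y hy => by
          obtain ⟨hy₁, hy₂⟩ := hG hy
          rcases (mem_pairImage_iff _ _ _).1 hy₁ with ⟨z, rfl⟩ | h
          · exact ⟨z, (hu₀ z).symm⟩
          · exact absurd h hy₂ }
  -- the mirrored count and `ref_off` clause of the `H`-fibration
  have hcountH : ∀ s : ℂ, ‖s‖ < R₁⁻¹ →
      wedgeCount (fun y => TV y - s)
        (ηV '' {p : E4 | p 0 ^ 2 + p 1 ^ 2 < R₁⁻¹ ^ 2} ∪
          ηC '' {p : E4 | p 0 ^ 2 + p 1 ^ 2 < R₁⁻¹ ^ 2 ∧ p 2 ^ 2 + p 3 ^ 2 < R₁⁻¹ ^ 2}) uH vH = 1 := by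
    intro s hs
    rw [wedgeCount_eq]
    by_cases hs0 : s = 0
    · subst hs0
      exact helper_hinfSphereVCount X R₁ ηH ηV ηC (fun y => TV y - 0) uH vH hR₁
        (fun p h₁ h₂ => by simp only [sub_zero]; exact hreadVC p h₁ h₂)
        (by simp only [sub_zero]; exact hzeroV) huH hvH hcompH hCH hdHV hdH
    · exact helper_hinfLevelVCount X M R₁ χ ι ηH ηV ηC TV uH vH hR₁ hHinj hHaxis hVcap hCH hreadVC
        hlevelV huH hvH hcompH s hs0 hs
  have hoffH : uH 0 ∉ ηV '' {p : E4 | p 0 ^ 2 + p 1 ^ 2 < R₁⁻¹ ^ 2} ∪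
      ηC '' {p : E4 | p 0 ^ 2 + p 1 ^ 2 < R₁⁻¹ ^ 2 ∧ p 2 ^ 2 + p 3 ^ 2 < R₁⁻¹ ^ 2} := by
    rw [huH0]
    exact axisH_zero_notMem hHinj hHaxis hVcap hCV hCH hdHV hdH hR₁
  exact ⟨u₀, v₀, uH, vH, F₀, FH, TH, TV, _, _, R₁⁻¹, D,
    helper_foliationData_symm ωX JX u₀ v₀ uH vH F₀ FH TH TV _ _ R₁⁻¹ D
      ⟨hembH.1, hembH.2.1, hembH.2.2.1, hembH.2.2.2⟩ ⟨hFH0, hFH1⟩ hcountH hoffH,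
    hu₀, hv₀, huH, hvH⟩

end Summit.SmoothPoincare4.SmoothPoincare4.Theorems.GromovRecognitionRelEnd.CrossCapLaurent

end
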